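import Literature.NumberTheory.LFunctions.Zhang2022.RepairSection18Boxes
import Literature.NumberTheory.LFunctions.Zhang2022.RepairSection18Closed

/-!
# Zhang (2022) §18-margin repair rung F-S1R: interval boxes of the UNREDUCED §18 residual
# `i(3𝔢″₁ + 3𝔢″₂ + 𝔢″₃) + e₁*` over a slice — `b*`, the stated `e″_{1j}`, the (12.15) pieces `A₃ⱼ, A₂ⱼ`,
# and the coefficients `R₃(θ), R₄(θ)`

Trunk T-ANT (NumberTheory/LFunctions). Y. Zhang, *Discrete mean estimates and the Landau–Siegel
zero*, arXiv:2211.02515v1 (2022) [Zhang2022LandauSiegel] — **an unrefereed manuscript under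
adjudication; nothing here asserts or denies its Theorems 1–2 or any analytic lemma; no claim about
Landau–Siegel zeros is made.** Rung F-S1R (human ruling D-0077), seat repair-p4 (annex [Q2-9]); the entry
layer that `RepairSection18Boxes` (p6) left out: boxes for the residual of the §18 reduction step.

p1's `RepairSection18Forms.identResidualT_eq` writes the unreduced `𝔠₃(θ)` of (18.1) as
`𝔠₃ = 𝔠₃ʳ + ῑ₃R₃(θ) + ῑ₄R₄(θ)` with
`R₃ = i(3e″₁e₃₁ + 3e″₂e₃₂ + e″₃e₃₃) − πb*(3A₃₁ + 6A₃₂ + 3A₃₃)`, `R₄` likewise with `(e₂ⱼ, A₂ⱼ)`; the printed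
margin functional `Margin232T` (the object whose value at `θ₀` is `Skeleton.Margin232`) sees `𝔠₃`, not `𝔠₃ʳ`.
From the closed forms of `RepairSection18Closed` (`bstarT_closed`, `e1ppT_closed`, `A3T_closed`, `A2T_closed`,
`integral_z_cexp_eq_expQuadIntR`, `integral_ffR_eq_expQuadIntR`) and p5's primitives (`expQuadIntBL`,
`expIpiFI`, `overPiFI`, `recipFI`, `scaleRatFI`) this file builds, for rational shifts `k` and fixed-point
intervals of the lengths / cut / windows:

* `expPrimB k Z ∋ e^{kπiz}/(kπi)` (`mem_expPrimB`), `aPiI a ∋ aπi`;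
* `bstarTB k₁ V₁ W ∋ b*(θ)` ((12.10); `mem_bstarTB`), `e1ppTB k₁ j V₁ Vc W ∋ e″_{1j}(θ)` (Lemma 15.1 as stated;
  `mem_e1ppTB`), `ATB k j V L ∋ A₃ⱼ(θ)` / `A₂ⱼ(θ)` ((12.15); `mem_A3TB`, `mem_A2TB`);
* `R3TB … ∋ R₃(θ)`, `R4TB … ∋ R₄(θ)` (`mem_R3TB`, `mem_R4TB`) under the flag `residOK`.

Consumed by `RepairTprintWitnessMargin` (the printed margin display at the corner `W`). Pure interval
bookkeeping (inclusion property of interval arithmetic); no analytic content, no new `Prop` facts, nothing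
about Theorems 1–2.

## References

* Y. Zhang, arXiv:2211.02515v1 (2022), §12 (12.10), (12.15), Lemma 15.1, §18 (18.1)–(18.2) p. 99,
  Appendix B (B.3). [cite: Zhang2022LandauSiegel, §§12, 15, 18, App. B]
* R. E. Moore, *Interval Analysis*, Prentice-Hall (1966), Theorem 3.1. [Moore1966]
-/

noncomputable section

open Complex Real ComplexConjugate
open Literature.Analysis.ValidatedNumerics.Numerics

namespace Literature.NumberTheory.LFunctions.Zhang2022

namespace Repair

attribute [local irreducible] CB.add CB.sub CB.mul CB.neg CB.conj CB.mulFI CB.mulI CB.mulInt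
  CB.ofFI CB.ofInt CB.normSqFI CB.expI FI.add FI.sub FI.mul FI.neg FI.mulInt FI.divNat FI.divPos
  FI.ofRat FI.ofInt FI.pi qCB piMul expIpi overPiFI piISq mulPiFI scaleRatFI recipFI
  recipMulPiFI expIpiFI

/-! ### Small plumbing -/

/-- `0 ∈ CB.ofInt 0`, `1 ∈ CB.ofInt 1`. [cite: Moore1966, Theorem 3.1] -/
theorem mem_zero_one : CB.mem (0 : ℂ) (CB.ofInt 0) ∧ CB.mem (1 : ℂ) (CB.ofInt 1) :=
  ⟨by simpa using CB.mem_ofInt 0, by simpa using CB.mem_ofInt 1⟩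

/-- box of `aπi` for a rational `a`. [folklore] -/
def aPiI (a : ℚ) : CB := ((qCB a).mulFI FI.pi).mulI

/-- `((a : ℝ) : ℂ)·π·i ∈ aPiI a`. [cite: Moore1966, Theorem 3.1] -/
theorem mem_aPiI (a : ℚ) : CB.mem ((((a : ℝ)) : ℂ) * π * I) (aPiI a) := by
  unfold aPiI; exact CB.mem_mulI (CB.mem_mulFI (mem_qCB' a) FI.mem_pi)

/-! ### The antiderivative `expPrim k z = e^{kπiz}/(kπi)` over an interval of `z` -/

/-- box of `expPrim k z` for `z ∈ Z`: `−i·(1/(kπ))·e^{(kz)πi}`. [cite: Zhang2022LandauSiegel, Appendix B (B.3)] -/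
@[irreducible] def expPrimB (k : ℚ) (Z : FI) : CB :=
  (((expIpiFI (scaleRatFI Z k)).mulFI (overPiFI k⁻¹)).mulI).neg

/-- validity flag of `expPrimB`. [folklore] -/
def expPrimOK (k : ℚ) (Z : FI) : Bool := overPiOK k⁻¹ && expIpiFIOK (scaleRatFI Z k)

/-- the closed form in box shape: `e^{kπiz}/(kπi) = −(e^{(kz)π i}·(k⁻¹/π))·i`. [cite: Zhang2022LandauSiegel, Appendix B (B.3)] -/
theorem expPrim_eq_box_shape {k : ℚ} (hk : k ≠ 0) (z : ℝ) :
    expPrim (k : ℝ) z = -((cexp (((((k : ℝ) * z * π : ℝ)) : ℂ) * I) * ((overPi k⁻¹ : ℝ) : ℂ)) * I) := by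
  unfold expPrim overPi
  have hk' : (k : ℂ) ≠ 0 := by exact_mod_cast hk
  have hπ : (π : ℂ) ≠ 0 := by exact_mod_cast Real.pi_ne_zero
  have e : cexp ((((k : ℝ)) : ℂ) * π * I * z) = cexp (((((k : ℝ) * z * π : ℝ)) : ℂ) * I) := by
    congr 1; push_cast; ring
  rw [e]
  push_cast
  field_simp
  rw [Complex.I_sq]
  ring

/-- **`expPrim k z ∈ expPrimB k Z`** for `z ∈ Z`, `k ≠ 0`, flag set. [cite: Moore1966, Theorem 3.1] -/
theorem mem_expPrimB {z : ℝ} {Z : FI} (hz : FI.mem z Z) {k : ℚ} (hk : k ≠ 0) (hok : expPrimOK k Z = true) :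
    CB.mem (expPrim (k : ℝ) z) (expPrimB k Z) := by
  unfold expPrimOK at hok
  rw [Bool.and_eq_true] at hok
  have hu := mem_overPiFI hok.1
  have he := mem_expIpiFI hok.2 (mem_scaleRatFI hz k)
  rw [expPrim_eq_box_shape hk z]
  unfold expPrimB
  exact CB.mem_neg (CB.mem_mulI (CB.mem_mulFI he hu))

/-! ### (12.10) `b*(θ)` over a slice -/

/-- box of `b*(θ) = (1/ν₁)·expQuadInt 0 1 0 k₁ (ν₁ − cut₁)` for `ν₁ ∈ V₁`, `ν₁ − cut₁ ∈ W`.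
[cite: Zhang2022LandauSiegel, §12 (12.10)] -/
@[irreducible] def bstarTB (k1 : ℚ) (V1 W : FI) : CB :=
  (expQuadIntBL (CB.ofInt 0) (CB.ofInt 1) (CB.ofInt 0) k1 W).mulFI (recipFI V1)

/-- validity flag of `bstarTB`. [folklore] -/
def bstarOK (k1 : ℚ) (V1 W : FI) : Bool := overPiOK k1⁻¹ && expIpiFIOK (scaleRatFI W k1) && recipOK V1

/-- **`b*(θ) ∈ bstarTB k₁ V₁ W`**. [cite: Moore1966, Theorem 3.1] -/
theorem mem_bstarTB {θ : Theta} {k1 : ℚ} {V1 W : FI} (hk : θ.k1 = k1) (hk0 : k1 ≠ 0)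
    (h1 : FI.mem θ.nu1 V1) (hw : FI.mem θ.win W) (hok : bstarOK k1 V1 W = true) :
    CB.mem (bstarT θ) (bstarTB k1 V1 W) := by
  simp only [bstarOK, Bool.and_eq_true] at hok
  obtain ⟨⟨hU, hE⟩, hR⟩ := hok
  have hθk : θ.k1 ≠ 0 := by rw [hk]; exact_mod_cast hk0
  rw [bstarT_closed θ hθk, integral_z_cexp_eq_expQuadIntR hθk, hk, expQuadIntR_ratCast, mul_comm]
  unfold bstarTB
  exact CB.mem_mulFI (mem_expQuadIntBL mem_zero_one.1 mem_zero_one.2 mem_zero_one.1 hw hU hE)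
    (mem_recipFI hR h1)

/-! ### Lemma 15.1 `e″_{1j}(θ)` AS STATED over a slice -/

/-- box of the stated `e″_{1j}(θ) = (j/(ν₁k₁))(expPrim k₁ ν₁ − expPrim k₁ cut₁ − (ν₁−cut₁)e^{k₁cut₁πi})` for
`ν₁ ∈ V₁`, `cut₁ ∈ Vc`, `ν₁ − cut₁ ∈ W`. [cite: Zhang2022LandauSiegel, Lemma 15.1] -/
@[irreducible] def e1ppTB (k1 : ℚ) (j : ℕ) (V1 Vc W : FI) : CB :=
  (((expPrimB k1 V1).sub (expPrimB k1 Vc)).sub ((CB.ofFI W).mul (expIpiFI (scaleRatFI Vc k1)))).mulFI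
    (scaleRatFI (recipFI V1) ((j : ℚ) / k1))

/-- validity flag of `e1ppTB`. [folklore] -/
def e1ppOK (k1 : ℚ) (V1 Vc : FI) : Bool := expPrimOK k1 V1 && expPrimOK k1 Vc && recipOK V1

/-- **`e″_{1j}(θ) ∈ e1ppTB k₁ j V₁ Vc W`**. [cite: Moore1966, Theorem 3.1] -/
theorem mem_e1ppTB {θ : Theta} {k1 : ℚ} {V1 Vc W : FI} (hk : θ.k1 = k1) (hk0 : k1 ≠ 0) (hn1 : θ.nu1 ≠ 0)
    (h1 : FI.mem θ.nu1 V1) (hc : FI.mem θ.cut1 Vc) (hw : FI.mem θ.win W) (hok : e1ppOK k1 V1 Vc = true)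
    (j : ℕ) : CB.mem (e1ppT θ j) (e1ppTB k1 j V1 Vc W) := by
  simp only [e1ppOK, expPrimOK, Bool.and_eq_true] at hok
  obtain ⟨⟨⟨hU, hE1⟩, ⟨-, hEc⟩⟩, hR⟩ := hok
  have hθk : θ.k1 ≠ 0 := by rw [hk]; exact_mod_cast hk0
  have hP1 := mem_expPrimB h1 hk0 (by unfold expPrimOK; rw [hU, hE1]; rfl)
  have hPc := mem_expPrimB hc hk0 (by unfold expPrimOK; rw [hU, hEc]; rfl)
  have hEc' := mem_expIpiFI hEc (mem_scaleRatFI hc k1)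
  have hco := mem_scaleRatFI (mem_recipFI hR h1) ((j : ℚ) / k1)
  have e : e1ppT θ j = (expPrim (k1 : ℝ) θ.nu1 - expPrim (k1 : ℝ) θ.cut1
        - (θ.win : ℂ) * cexp (((((k1 : ℝ) * θ.cut1 * π : ℝ)) : ℂ) * I))
      * ((((((j : ℚ) / k1 : ℚ)) : ℝ) * (1 / θ.nu1) : ℝ) : ℂ) := by
    rw [e1ppT_closed θ hθk j, hk]
    have hk' : (k1 : ℂ) ≠ 0 := by exact_mod_cast hk0
    have hn' : (θ.nu1 : ℂ) ≠ 0 := by exact_mod_cast hn1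
    have ee : cexp (((((k1 : ℝ) * θ.cut1 : ℝ)) : ℂ) * π * I) = cexp (((((k1 : ℝ) * θ.cut1 * π : ℝ)) : ℂ) * I) := by
      congr 1; push_cast; ring
    rw [ee]
    push_cast
    field_simp
  rw [e]
  unfold e1ppTB
  exact CB.mem_mulFI (CB.mem_sub (CB.mem_sub hP1 hPc) (CB.mem_mul (CB.mem_ofFI hw) hEc')) hco

/-! ### (12.15) pieces `A₃ⱼ(θ), A₂ⱼ(θ)` over a slice -/

/-- box of `(expQuadInt 1 ((k−j)πi) 0 k ν − expQuadInt 1 ((k−j)πi) 0 k L)/ν` for `ν ∈ V`, `L ∈ LI`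
(`A₃ⱼ` with `(k, ν, L) = (k₃, ν₃, L₆)`, `A₂ⱼ` with `(k₂, ν₂, L₇)`). [cite: Zhang2022LandauSiegel, §12 after (12.15)] -/
@[irreducible] def ATB (k : ℚ) (j : ℕ) (V LI : FI) : CB :=
  ((expQuadIntBL (CB.ofInt 1) (aPiI (k - j)) (CB.ofInt 0) k V).sub
    (expQuadIntBL (CB.ofInt 1) (aPiI (k - j)) (CB.ofInt 0) k LI)).mulFI (recipFI V)

/-- validity flag of `ATB`. [folklore] -/
def ATOK (k : ℚ) (V LI : FI) : Bool :=
  overPiOK k⁻¹ && expIpiFIOK (scaleRatFI V k) && expIpiFIOK (scaleRatFI LI k) && recipOK V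

/-- the closed form in box shape: `(ffRPrim a k ν − ffRPrim a k L)/ν` as a difference of two `expQuadInt`
times `1/ν`, `a = k − j`. [cite: Zhang2022LandauSiegel, §12 after (12.15)] -/
theorem ffRPrim_sub_eq_box_shape {k : ℚ} (hk : k ≠ 0) (j : ℕ) {ν : ℝ} (L : ℝ) :
    (ffRPrim ((k : ℝ) - j) (k : ℝ) ν - ffRPrim ((k : ℝ) - j) (k : ℝ) L) / (ν : ℂ)
      = (expQuadInt 1 ((((k - j : ℚ)) : ℝ) * π * I) 0 k ν - expQuadInt 1 ((((k - j : ℚ)) : ℝ) * π * I) 0 k L)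
        * (((1 / ν : ℝ)) : ℂ) := by
  have hk' : (k : ℝ) ≠ 0 := by exact_mod_cast hk
  have e : ffRPrim ((k : ℝ) - j) (k : ℝ) ν - ffRPrim ((k : ℝ) - j) (k : ℝ) L
      = (ffRPrim ((k : ℝ) - j) (k : ℝ) ν - ffRPrim ((k : ℝ) - j) (k : ℝ) 0)
        - (ffRPrim ((k : ℝ) - j) (k : ℝ) L - ffRPrim ((k : ℝ) - j) (k : ℝ) 0) := by ring
  have ea : (((((k : ℝ) - j : ℝ)) : ℂ) * π * I) = ((((k - j : ℚ)) : ℝ) : ℂ) * π * I := by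
    push_cast; ring
  rw [e, integral_ffR_eq_expQuadIntR _ hk', integral_ffR_eq_expQuadIntR _ hk', expQuadIntR_ratCast,
    expQuadIntR_ratCast, ea, div_eq_mul_one_div]
  push_cast
  ring

/-- **`A₃ⱼ(θ) ∈ ATB k₃ j V₃ L6I`**. [cite: Moore1966, Theorem 3.1] -/
theorem mem_A3TB {θ : Theta} {k3 : ℚ} {V3 LI : FI} (hk : θ.k3 = k3) (hk0 : k3 ≠ 0)
    (h3 : FI.mem θ.nu3 V3) (hL : FI.mem θ.L6 LI) (hok : ATOK k3 V3 LI = true) (j : ℕ) :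
    CB.mem (A3T θ j) (ATB k3 j V3 LI) := by
  simp only [ATOK, Bool.and_eq_true] at hok
  obtain ⟨⟨⟨hU, hEV⟩, hEL⟩, hR⟩ := hok
  have hθk : θ.k3 ≠ 0 := by rw [hk]; exact_mod_cast hk0
  rw [A3T_closed θ hθk j, hk, ffRPrim_sub_eq_box_shape hk0 j]
  unfold ATB
  exact CB.mem_mulFI (CB.mem_sub
    (mem_expQuadIntBL mem_zero_one.2 (mem_aPiI _) mem_zero_one.1 h3 hU hEV)
    (mem_expQuadIntBL mem_zero_one.2 (mem_aPiI _) mem_zero_one.1 hL hU hEL)) (mem_recipFI hR h3)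

/-- **`A₂ⱼ(θ) ∈ ATB k₂ j V₂ L7I`**. [cite: Moore1966, Theorem 3.1] -/
theorem mem_A2TB {θ : Theta} {k2 : ℚ} {V2 LI : FI} (hk : θ.k2 = k2) (hk0 : k2 ≠ 0)
    (h2 : FI.mem θ.nu2 V2) (hL : FI.mem θ.L7 LI) (hok : ATOK k2 V2 LI = true) (j : ℕ) :
    CB.mem (A2T θ j) (ATB k2 j V2 LI) := by
  simp only [ATOK, Bool.and_eq_true] at hok
  obtain ⟨⟨⟨hU, hEV⟩, hEL⟩, hR⟩ := hok
  have hθk : θ.k2 ≠ 0 := by rw [hk]; exact_mod_cast hk0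
  rw [A2T_closed θ hθk j, hk, ffRPrim_sub_eq_box_shape hk0 j]
  unfold ATB
  exact CB.mem_mulFI (CB.mem_sub
    (mem_expQuadIntBL mem_zero_one.2 (mem_aPiI _) mem_zero_one.1 h2 hU hEV)
    (mem_expQuadIntBL mem_zero_one.2 (mem_aPiI _) mem_zero_one.1 hL hU hEL)) (mem_recipFI hR h2)

/-! ### The residual coefficients `R₃(θ), R₄(θ)` over a slice -/

/-- box of `R₃(θ) = i(3e″₁e₃₁ + 3e″₂e₃₂ + e″₃e₃₃) − πb*(3A₃₁ + 6A₃₂ + 3A₃₃)`.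
[cite: Zhang2022LandauSiegel, §18 before (18.2)] -/
@[irreducible] def R3TB (k1 k3 : ℚ) (V1 V3 Vc W L6I : FI) : CB :=
  ((((((e1ppTB k1 1 V1 Vc W).mul (eRB k3 1 V3)).mulInt 3).add
      (((e1ppTB k1 2 V1 Vc W).mul (eRB k3 2 V3)).mulInt 3)).add
      ((e1ppTB k1 3 V1 Vc W).mul (eRB k3 3 V3))).mulI).sub
    (((bstarTB k1 V1 W).mulFI FI.pi).mul
      (((((ATB k3 1 V3 L6I).mulInt 3).add ((ATB k3 2 V3 L6I).mulInt 6)).add ((ATB k3 3 V3 L6I).mulInt 3))))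

/-- box of `R₄(θ) = i(3e″₁e₂₁ + 3e″₂e₂₂ + e″₃e₂₃) − πb*(3A₂₁ + 6A₂₂ + 3A₂₃)`.
[cite: Zhang2022LandauSiegel, §18 before (18.2)] -/
@[irreducible] def R4TB (k1 k2 : ℚ) (V1 V2 Vc W L7I : FI) : CB :=
  ((((((e1ppTB k1 1 V1 Vc W).mul (eRB k2 1 V2)).mulInt 3).add
      (((e1ppTB k1 2 V1 Vc W).mul (eRB k2 2 V2)).mulInt 3)).add
      ((e1ppTB k1 3 V1 Vc W).mul (eRB k2 3 V2))).mulI).sub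
    (((bstarTB k1 V1 W).mulFI FI.pi).mul
      (((((ATB k2 1 V2 L7I).mulInt 3).add ((ATB k2 2 V2 L7I).mulInt 6)).add ((ATB k2 3 V2 L7I).mulInt 3))))

/-- validity flags of `R3TB`/`R4TB`. [folklore] -/
def residOK (k1 k2 k3 : ℚ) (V1 V2 V3 Vc W L6I L7I : FI) : Bool :=
  e1ppOK k1 V1 Vc && bstarOK k1 V1 W && eROK k3 V3 && eROK k2 V2 && ATOK k3 V3 L6I && ATOK k2 V2 L7I

/-- the residual combination in box shape (pure algebra). [cite: Zhang2022LandauSiegel, §18 before (18.2)] -/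
theorem resid_eq_box_shape (P1 P2 P3 E1 E2 E3 B A1 A2 A3 : ℂ) :
    I * (3 * (P1 * E1) + 3 * (P2 * E2) + P3 * E3) - π * B * (3 * A1 + 6 * A2 + 3 * A3)
      = (P1 * E1 * ((3 : ℤ) : ℂ) + P2 * E2 * ((3 : ℤ) : ℂ) + P3 * E3) * I
        - B * ((π : ℝ) : ℂ) * (A1 * ((3 : ℤ) : ℂ) + A2 * ((6 : ℤ) : ℂ) + A3 * ((3 : ℤ) : ℂ)) := by
  push_cast; ring

/-- **`R₃(θ) ∈ R3TB …`** on a slice. [cite: Moore1966, Theorem 3.1] -/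
theorem mem_R3TB {θ : Theta} {k1 k2 k3 : ℚ} {V1 V2 V3 Vc W L6I L7I : FI}
    (hk1 : θ.k1 = k1) (hk3 : θ.k3 = k3) (hk10 : k1 ≠ 0) (hk30 : k3 ≠ 0) (hn1 : θ.nu1 ≠ 0) (hn3 : θ.nu3 ≠ 0)
    (h1 : FI.mem θ.nu1 V1) (h3 : FI.mem θ.nu3 V3) (hc : FI.mem θ.cut1 Vc) (hw : FI.mem θ.win W)
    (hL6 : FI.mem θ.L6 L6I) (hok : residOK k1 k2 k3 V1 V2 V3 Vc W L6I L7I = true) :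
    CB.mem (R3T θ) (R3TB k1 k3 V1 V3 Vc W L6I) := by
  simp only [residOK, Bool.and_eq_true] at hok
  obtain ⟨⟨⟨⟨⟨hpp, hb⟩, he3⟩, -⟩, hA3⟩, -⟩ := hok
  have hP := fun j => mem_e1ppTB hk1 hk10 hn1 h1 hc hw hpp j
  have hE : ∀ j, CB.mem (e3T θ j) (eRB k3 j V3) := fun j => by
    unfold e3T; rw [hk3]; exact mem_eRB h3 hn3 hk30 he3 j
  have hB := mem_bstarTB hk1 hk10 h1 hw hb
  have hA := fun j => mem_A3TB hk3 hk30 h3 hL6 hA3 j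
  unfold R3T
  rw [resid_eq_box_shape]
  unfold R3TB
  exact CB.mem_sub
    (CB.mem_mulI (CB.mem_add (CB.mem_add (CB.mem_mulInt (CB.mem_mul (hP 1) (hE 1)) 3)
      (CB.mem_mulInt (CB.mem_mul (hP 2) (hE 2)) 3)) (CB.mem_mul (hP 3) (hE 3))))
    (CB.mem_mul (CB.mem_mulFI hB FI.mem_pi) (CB.mem_add (CB.mem_add (CB.mem_mulInt (hA 1) 3)
      (CB.mem_mulInt (hA 2) 6)) (CB.mem_mulInt (hA 3) 3)))

/-- **`R₄(θ) ∈ R4TB …`** on a slice. [cite: Moore1966, Theorem 3.1] -/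
theorem mem_R4TB {θ : Theta} {k1 k2 k3 : ℚ} {V1 V2 V3 Vc W L6I L7I : FI}
    (hk1 : θ.k1 = k1) (hk2 : θ.k2 = k2) (hk10 : k1 ≠ 0) (hk20 : k2 ≠ 0) (hn1 : θ.nu1 ≠ 0) (hn2 : θ.nu2 ≠ 0)
    (h1 : FI.mem θ.nu1 V1) (h2 : FI.mem θ.nu2 V2) (hc : FI.mem θ.cut1 Vc) (hw : FI.mem θ.win W)
    (hL7 : FI.mem θ.L7 L7I) (hok : residOK k1 k2 k3 V1 V2 V3 Vc W L6I L7I = true) :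
    CB.mem (R4T θ) (R4TB k1 k2 V1 V2 Vc W L7I) := by
  simp only [residOK, Bool.and_eq_true] at hok
  obtain ⟨⟨⟨⟨⟨hpp, hb⟩, -⟩, he2⟩, -⟩, hA2⟩ := hok
  have hP := fun j => mem_e1ppTB hk1 hk10 hn1 h1 hc hw hpp j
  have hE : ∀ j, CB.mem (e2T θ j) (eRB k2 j V2) := fun j => by
    unfold e2T; rw [hk2]; exact mem_eRB h2 hn2 hk20 he2 j
  have hB := mem_bstarTB hk1 hk10 h1 hw hb
  have hA := fun j => mem_A2TB hk2 hk20 h2 hL7 hA2 j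
  unfold R4T
  rw [resid_eq_box_shape]
  unfold R4TB
  exact CB.mem_sub
    (CB.mem_mulI (CB.mem_add (CB.mem_add (CB.mem_mulInt (CB.mem_mul (hP 1) (hE 1)) 3)
      (CB.mem_mulInt (CB.mem_mul (hP 2) (hE 2)) 3)) (CB.mem_mul (hP 3) (hE 3))))
    (CB.mem_mul (CB.mem_mulFI hB FI.mem_pi) (CB.mem_add (CB.mem_add (CB.mem_mulInt (hA 1) 3)
      (CB.mem_mulInt (hA 2) 6)) (CB.mem_mulInt (hA 3) 3)))

end Repair

end Literature.NumberTheory.LFunctions.Zhang2022
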